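import Mathlib
import HarnessLib
import Summits.HubbardSuperconductivity.HubbardSuperconductivity.Theorems.KLProgrammeThermalGreenHighFrequency
import Summits.HubbardSuperconductivity.HubbardSuperconductivity.Theorems.JosephsonMirrorFreeLayersPairBounds
import Literature.MathematicalPhysics.QuantumLattice.HubbardMomentumModeCommutators
import Literature.MathematicalPhysics.QuantumLattice.ApproximatingHamiltonianProofs
import Literature.MathematicalPhysics.QuantumLattice.TorusCooperSum

/-!
# The Matsubara Green function of the 2D Hubbard torus equals the free one up to `O_β(1)/k₀²`, uniformly in the volume, for EVERY
# coupling: an a-priori bound for clause (i) of the volume-limit text (seat hubbard-kl-k3c5-p2, g2)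

Route `KLProgramme`, child 5 `KLRegimeVolumeLimitV11` (stmt-HubbardSuperconductivity-19826).  The carrier of `FinalTwoLegVolLimit` is, frame by
frame, the momentum-space two-point ratio re-amputated by the free propagator (`…VolumeLimitFrameReduction`:
`βL² ĝ_K² Σ̂^K = N/D + βL² ĝ_K`), and clause (i) asks for an `(L, M)`-uniform bound at ALL Matsubara frequencies.  On the Hamiltonian side
(`M = ∞`, the tree's `hubbardTorusWith 2 L 1 U μ`, `Matrix.gibbsState`, `Matrix.imagTimeEvolve`, Bloch modes `momentumAnnihilation k σ` /
`momentumCreation k σ`) this bound holds for EVERY real `U`, uniformly in `L ≥ 3`, by the sum-rule asymptotics of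
`…ThermalGreenHighFrequency` (two fermionic integrations by parts + KMS) and three operator-norm facts: `{c_{k↑}, c†_{k↑}} = 1`,
`‖c_{k↑}‖, ‖c†_{k↑}‖ ≤ 1`, and `‖[H − μN, c_{k↑}]‖ ≤ |ε_L(k) − μ| + |U|` (the interaction part of the commutator is `U` times the DRESSED
mode `T_k† `, a quasi-fermion of norm `≤ 1`: `dressed_anticommutator`, `sum_normSq_planeWaveCoeff` of `HubbardMomentumModeCommutators`).

Main results (`H' = hubbardTorusWith 2 L 1 U μ`, `ξ = torusBand L k − μ`, `k₀` with `e^{ik₀β} = −1`, `β > 0`, `L ≥ 3`, spin `↑`):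
* `norm_comm_hubbardTorusWith_momentumAnnihilation_le` : `‖H' c_{k↑} − c_{k↑} H'‖ ≤ |ξ| + |U|` (and the creation twin);
* `norm_matsubaraGreen_sub_sumRules_le` :
  `‖∫₀^β e^{ik₀τ}⟨c_{k↑}(τ)c†_{k↑}⟩ dτ + 1/(ik₀) − m₁/(ik₀)²‖ ≤ β(|ξ|+|U|)²/k₀²`, `m₁ = ⟨[H',c]c† + c†[H',c]⟩`, `‖m₁‖ ≤ 2(|ξ|+|U|)`;
* `norm_reamputated_matsubaraGreen_le` : with the FREE value `ĝ = 1/(−ik₀ + ξ)` (the `U = 0` Green function in these conventions),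
  `‖(ĝ − ∫₀^β e^{ik₀τ}⟨c_{k↑}(τ)c†_{k↑}⟩dτ)·(−ik₀+ξ)²‖ ≤ (1 + ξ²/k₀²)·(3|ξ| + 2|U| + ξ²/|k₀| + β(|ξ|+|U|)²)` —
  bounded uniformly in `L`, `k` and `k₀` at fixed `(β, U, μ)` (`|k₀| ≥ π/β`, `|ξ| ≤ 4 + |μ|`).
What carries this to clause (i) of the VL text at finite Matsubara cutoff `M` is a frequency-resolved version of the all-`U` Matsubara limit
(`…TwoPointAssemblyMatsubaraAllU`, equal-time today) — not in this file.  Everything is proved; no definition.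
-/

noncomputable section

namespace Summit.HubbardSuperconductivity.HubbardSuperconductivity.Theorems.ThermalGreen

set_option linter.dupNamespace false -- summit = problem name (single-conjunct summit), D-0017

open scoped Matrix.Norms.L2Operator ComplexConjugate ComplexOrder
open Matrix Complex MeasureTheory intervalIntegral Literature.MathematicalPhysics.QuantumLattice Literature.Probability.LatticeModels
open HubbardWave0 ThermodynamicLimit Summit.HubbardSuperconductivity.HubbardSuperconductivity.Theorems.JosephsonMirror

/-! ## §1 Operator norms from quadratic-form bounds -/

/-- **`ℓ²` operator norm from a quadratic-form bound**: if `‖Tψ‖² ≤ c‖ψ‖²` for all `ψ` then `‖T‖ ≤ √c`. -/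
theorem l2_opNorm_le_sqrt_of_normSq_mulVec_le {m : Type*} [Fintype m] [DecidableEq m] (T : Matrix m m ℂ) {c : ℝ} (hc : 0 ≤ c)
    (h : ∀ ψ : m → ℂ, (star (T *ᵥ ψ) ⬝ᵥ (T *ᵥ ψ)).re ≤ c * (star ψ ⬝ᵥ ψ).re) : ‖T‖ ≤ Real.sqrt c := by
  rw [Matrix.l2_opNorm_def]
  refine ContinuousLinearMap.opNorm_le_bound _ (Real.sqrt_nonneg _) fun x => ?_
  have happ : ((Matrix.toEuclideanLin (𝕜 := ℂ) (m := m) (n := m)).trans LinearMap.toContinuousLinearMap T) x =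
      WithLp.toLp 2 (T *ᵥ WithLp.ofLp x) := rfl
  rw [happ]
  have h1 := h (WithLp.ofLp x)
  rw [← norm_toLp_sq, ← norm_toLp_sq, WithLp.toLp_ofLp] at h1
  have h2 : ‖(WithLp.toLp 2 (T *ᵥ WithLp.ofLp x) : EuclideanSpace ℂ m)‖ ^ 2 ≤ (Real.sqrt c * ‖x‖) ^ 2 := by
    rw [mul_pow, Real.sq_sqrt hc]; exact h1
  exact (pow_le_pow_iff_left₀ (norm_nonneg _) (by positivity) two_ne_zero).mp h2

variable {L : ℕ} [NeZero L]

/-- `‖c_{kσ}‖ ≤ 1` for a Bloch mode (CAR, `…JosephsonMirrorFreeLayersPairBounds.re_norm_momentumAnnihilation_mulVec_le`). -/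
theorem norm_momentumAnnihilation_le_one (k : TorusSite 2 L) (σ : Fin 2) :
    ‖(momentumAnnihilation k σ : Matrix _ _ ℂ)‖ ≤ 1 := by
  have h := l2_opNorm_le_sqrt_of_normSq_mulVec_le (momentumAnnihilation k σ) zero_le_one fun ψ => by
    rw [one_mul]; exact re_norm_momentumAnnihilation_mulVec_le k σ ψ
  rwa [Real.sqrt_one] at h

/-- `‖c†_{kσ}‖ ≤ 1`. -/
theorem norm_momentumCreation_le_one (k : TorusSite 2 L) (σ : Fin 2) : ‖(momentumCreation k σ : Matrix _ _ ℂ)‖ ≤ 1 := by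
  rw [momentumCreation, Matrix.l2_opNorm_conjTranspose]
  exact norm_momentumAnnihilation_le_one k σ

/-- **The adjoint dressed mode has norm `≤ 1`**: `‖(Σ_z L⁻¹χ_k(z) n_{z↓} c†_{z↑})ᴴ‖ ≤ 1` (quasi-fermion, `Σ|L⁻¹χ_k|² = 1`). -/
theorem norm_dressed_conjTranspose_le_one (k : TorusSite 2 L) :
    ‖(∑ z : FermionTorus 2 L, (torusFourierWeight 2 L * torusChar k z.toTorusSite) • (numberOp z 1 * creation (orb z 0)))ᴴ‖ ≤ 1 := by
  have h := l2_opNorm_le_sqrt_of_normSq_mulVec_le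
    ((∑ z : FermionTorus 2 L, (torusFourierWeight 2 L * torusChar k z.toTorusSite) • (numberOp z 1 * creation (orb z 0)))ᴴ)
    zero_le_one fun ψ => by
      have := normSq_dressed_conjTranspose_mulVec_le (fun z : FermionTorus 2 L => torusFourierWeight 2 L * torusChar k z.toTorusSite) ψ
      rwa [sum_normSq_planeWaveCoeff] at this
  rwa [Real.sqrt_one] at h

/-! ## §2 The commutator of the grand-canonical Hamiltonian with a Bloch mode -/

/-- **`[H − μN, c_{k↑}] = −(ε_L(k) − μ) c_{k↑} − U T_k†`** (`L ≥ 3`; `hubbardTorus_commutator_momentumAnnihilation` and `[N, c] = −c`). -/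
theorem hubbardTorusWith_commutator_momentumAnnihilation (hL : 3 ≤ L) (U μ : ℝ) (k : TorusSite 2 L) :
    hubbardTorusWith 2 L 1 U μ * momentumAnnihilation k 0 - momentumAnnihilation k 0 * hubbardTorusWith 2 L 1 U μ =
      -(((torusBand L k - μ : ℝ) : ℂ) • momentumAnnihilation k 0) -
        (U : ℂ) • (∑ z : FermionTorus 2 L, (torusFourierWeight 2 L * torusChar k z.toTorusSite) •
          (numberOp z 1 * creation (orb z 0)))ᴴ := by
  have hH := hubbardTorus_commutator_momentumAnnihilation hL U k
  have hN : (totalNumber : Matrix (Finset (Orb (FermionTorus 2 L))) _ ℂ) * momentumAnnihilation k 0 -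
      momentumAnnihilation k 0 * totalNumber = -momentumAnnihilation k 0 := by
    rw [totalNumber_eq_spinWeightedNumber, spinWeightedNumber_commutator_momentumAnnihilation, one_smul]
  have hexp : hubbardTorusWith 2 L 1 U μ * momentumAnnihilation k 0 - momentumAnnihilation k 0 * hubbardTorusWith 2 L 1 U μ =
      (hubbardTorus 2 L 1 U * momentumAnnihilation k 0 - momentumAnnihilation k 0 * hubbardTorus 2 L 1 U) -
        (μ : ℂ) • ((totalNumber : Matrix (Finset (Orb (FermionTorus 2 L))) _ ℂ) * momentumAnnihilation k 0 -
          momentumAnnihilation k 0 * totalNumber) := by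
    rw [hubbardTorusWith_eq, Matrix.sub_mul, Matrix.mul_sub, Matrix.smul_mul, Matrix.mul_smul, smul_sub]
    abel
  rw [hexp, hH, hN, Complex.ofReal_sub, sub_smul, smul_neg]
  abel

/-- **`‖[H − μN, c_{k↑}]‖ ≤ |ε_L(k) − μ| + |U|`**, uniformly in the volume. -/
theorem norm_comm_hubbardTorusWith_momentumAnnihilation_le (hL : 3 ≤ L) (U μ : ℝ) (k : TorusSite 2 L) :
    ‖hubbardTorusWith 2 L 1 U μ * momentumAnnihilation k 0 - momentumAnnihilation k 0 * hubbardTorusWith 2 L 1 U μ‖ ≤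
      |torusBand L k - μ| + |U| := by
  rw [hubbardTorusWith_commutator_momentumAnnihilation hL U μ k]
  refine (norm_sub_le _ _).trans (add_le_add ?_ ?_)
  · rw [norm_neg, norm_smul, Complex.norm_real, Real.norm_eq_abs]
    exact mul_le_of_le_one_right (abs_nonneg _) (norm_momentumAnnihilation_le_one k 0)
  · rw [norm_smul, Complex.norm_real, Real.norm_eq_abs]
    exact mul_le_of_le_one_right (abs_nonneg _) (norm_dressed_conjTranspose_le_one k)

/-- **`‖[H − μN, c†_{k↑}]‖ ≤ |ε_L(k) − μ| + |U|`** (adjoint). -/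
theorem norm_comm_hubbardTorusWith_momentumCreation_le (hL : 3 ≤ L) (U μ : ℝ) (k : TorusSite 2 L) :
    ‖hubbardTorusWith 2 L 1 U μ * momentumCreation k 0 - momentumCreation k 0 * hubbardTorusWith 2 L 1 U μ‖ ≤
      |torusBand L k - μ| + |U| := by
  have hH : (hubbardTorusWith 2 L 1 U μ)ᴴ = hubbardTorusWith 2 L 1 U μ := (isHermitian_hamiltonianWith (fermionTorusGraph 2 L) 1 U μ).eq
  have hct : (hubbardTorusWith 2 L 1 U μ * momentumAnnihilation k 0 - momentumAnnihilation k 0 * hubbardTorusWith 2 L 1 U μ)ᴴ =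
      -(hubbardTorusWith 2 L 1 U μ * momentumCreation k 0 - momentumCreation k 0 * hubbardTorusWith 2 L 1 U μ) := by
    rw [conjTranspose_sub, conjTranspose_mul, conjTranspose_mul, momentumAnnihilation_conjTranspose, hH, neg_sub]
  rw [← norm_neg, ← hct, Matrix.l2_opNorm_conjTranspose]
  exact norm_comm_hubbardTorusWith_momentumAnnihilation_le hL U μ k

/-! ## §3 The Matsubara Green function of the torus: sum-rule asymptotics for every coupling -/

/-- **SUM-RULE ASYMPTOTICS OF THE HUBBARD MATSUBARA GREEN FUNCTION, ALL `U`, UNIFORM IN `L`.**  For `L ≥ 3`, `β ≥ 0`, a fermionic frequency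
`k₀` (`e^{ik₀β} = −1`) and `H' = hubbardTorusWith 2 L 1 U μ`:
`‖∫₀^β e^{ik₀τ}⟨c_{k↑}(τ)c†_{k↑}⟩_{H'} dτ + ⟨{c,c†}⟩/(ik₀) − ⟨{[H',c],c†}⟩/(ik₀)²‖ ≤ β(|ε_L(k)−μ| + |U|)²/k₀²`. -/
theorem norm_matsubaraGreen_sub_sumRules_le (hL : 3 ≤ L) (U μ : ℝ) {β : ℝ} (hβ : 0 ≤ β) (k : TorusSite 2 L) {k₀ : ℝ}
    (hk : cexp (I * k₀ * β) = -1) :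
    ‖(∫ τ in (0 : ℝ)..β, cexp (I * k₀ * τ) * gibbsState β (hubbardTorusWith 2 L 1 U μ)
          (imagTimeEvolve (hubbardTorusWith 2 L 1 U μ) (τ : ℂ) (momentumAnnihilation k 0) * momentumCreation k 0)) +
        gibbsState β (hubbardTorusWith 2 L 1 U μ) (momentumAnnihilation k 0 * momentumCreation k 0 +
            momentumCreation k 0 * momentumAnnihilation k 0) / (I * k₀) -
          gibbsState β (hubbardTorusWith 2 L 1 U μ)
            ((hubbardTorusWith 2 L 1 U μ * momentumAnnihilation k 0 - momentumAnnihilation k 0 * hubbardTorusWith 2 L 1 U μ) *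
                momentumCreation k 0 +
              momentumCreation k 0 *
                (hubbardTorusWith 2 L 1 U μ * momentumAnnihilation k 0 - momentumAnnihilation k 0 * hubbardTorusWith 2 L 1 U μ)) /
            (I * k₀) ^ 2‖ ≤
      β * (|torusBand L k - μ| + |U|) ^ 2 / k₀ ^ 2 := by
  haveI : Nonempty (Finset (Orb (FermionTorus 2 L))) := ⟨∅⟩
  have hH := isHermitian_hamiltonianWith (fermionTorusGraph 2 L) 1 U μ
  refine (norm_fermionic_matsubara_sub_sumRules_le (H := hubbardTorusWith 2 L 1 U μ) hH hβ (momentumAnnihilation k 0)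
    (momentumCreation k 0) hk).trans ?_
  rw [sq (|torusBand L k - μ| + |U|)]
  gcongr
  · exact norm_comm_hubbardTorusWith_momentumAnnihilation_le hL U μ k
  · exact norm_comm_hubbardTorusWith_momentumCreation_le hL U μ k

/-- The CAR inside the state: `⟨c_{k↑}c†_{k↑} + c†_{k↑}c_{k↑}⟩_{H'} = 1`. -/
theorem gibbsState_momentum_car (U μ β : ℝ) (k : TorusSite 2 L) :
    gibbsState β (hubbardTorusWith 2 L 1 U μ) (momentumAnnihilation k 0 * momentumCreation k 0 +
        momentumCreation k 0 * momentumAnnihilation k 0) = 1 := by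
  haveI : Nonempty (Finset (Orb (FermionTorus 2 L))) := ⟨∅⟩
  rw [momentumAnnihilation_mul_momentumCreation_add, if_pos ⟨rfl, rfl⟩]
  exact gibbsState_one β _ (Matrix.partitionFn_pos β (isHermitian_hamiltonianWith (fermionTorusGraph 2 L) 1 U μ)).ne'

/-- The first moment is volume-uniformly bounded: `‖⟨{[H',c_{k↑}], c†_{k↑}}⟩_{H'}‖ ≤ 2(|ε_L(k) − μ| + |U|)`. -/
theorem norm_gibbsState_firstMoment_le (hL : 3 ≤ L) (U μ β : ℝ) (k : TorusSite 2 L) :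
    ‖gibbsState β (hubbardTorusWith 2 L 1 U μ)
        ((hubbardTorusWith 2 L 1 U μ * momentumAnnihilation k 0 - momentumAnnihilation k 0 * hubbardTorusWith 2 L 1 U μ) *
            momentumCreation k 0 +
          momentumCreation k 0 *
            (hubbardTorusWith 2 L 1 U μ * momentumAnnihilation k 0 - momentumAnnihilation k 0 * hubbardTorusWith 2 L 1 U μ))‖ ≤
      2 * (|torusBand L k - μ| + |U|) := by
  haveI : Nonempty (Finset (Orb (FermionTorus 2 L))) := ⟨∅⟩
  have hH := isHermitian_hamiltonianWith (fermionTorusGraph 2 L) 1 U μ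
  set C := hubbardTorusWith 2 L 1 U μ * momentumAnnihilation k 0 - momentumAnnihilation k 0 * hubbardTorusWith 2 L 1 U μ with hC
  have hCn : ‖C‖ ≤ |torusBand L k - μ| + |U| := norm_comm_hubbardTorusWith_momentumAnnihilation_le hL U μ k
  have hB : ‖(momentumCreation k 0 : Matrix (Finset (Orb (FermionTorus 2 L))) _ ℂ)‖ ≤ 1 := norm_momentumCreation_le_one k 0
  refine (norm_gibbsState_le (H := hubbardTorusWith 2 L 1 U μ) hH β _).trans ?_
  calc ‖C * momentumCreation k 0 + momentumCreation k 0 * C‖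
      ≤ ‖C‖ * ‖(momentumCreation k 0 : Matrix (Finset (Orb (FermionTorus 2 L))) _ ℂ)‖ +
          ‖(momentumCreation k 0 : Matrix (Finset (Orb (FermionTorus 2 L))) _ ℂ)‖ * ‖C‖ :=
        (norm_add_le _ _).trans (add_le_add (norm_mul_le _ _) (norm_mul_le _ _))
    _ ≤ (|torusBand L k - μ| + |U|) * 1 + 1 * (|torusBand L k - μ| + |U|) := by
        gcongr
    _ = 2 * (|torusBand L k - μ| + |U|) := by ring

/-- **THE RE-AMPUTATED MATSUBARA GREEN FUNCTION IS BOUNDED, ALL `U`, UNIFORMLY IN THE VOLUME.**  With the free value `ĝ = 1/(−ik₀ + ξ)`,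
`ξ = ε_L(k) − μ`, and `𝒢 = ∫₀^β e^{ik₀τ}⟨c_{k↑}(τ)c†_{k↑}⟩_{H'}dτ` (`L ≥ 3`, `0 ≤ β`, `e^{ik₀β} = −1`):
`‖(ĝ − 𝒢)(−ik₀ + ξ)²‖ ≤ (1 + ξ²/k₀²)·(3|ξ| + 2|U| + ξ²/|k₀| + β(|ξ| + |U|)²)`. -/
theorem norm_reamputated_matsubaraGreen_le (hL : 3 ≤ L) (U μ : ℝ) {β : ℝ} (hβ : 0 ≤ β) (k : TorusSite 2 L) {k₀ : ℝ}
    (hk : cexp (I * k₀ * β) = -1) :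
    ‖(1 / (-I * k₀ + ((torusBand L k - μ : ℝ) : ℂ)) -
          ∫ τ in (0 : ℝ)..β, cexp (I * k₀ * τ) * gibbsState β (hubbardTorusWith 2 L 1 U μ)
            (imagTimeEvolve (hubbardTorusWith 2 L 1 U μ) (τ : ℂ) (momentumAnnihilation k 0) * momentumCreation k 0)) *
        (-I * k₀ + ((torusBand L k - μ : ℝ) : ℂ)) ^ 2‖ ≤
      (1 + (torusBand L k - μ) ^ 2 / k₀ ^ 2) *
        (3 * |torusBand L k - μ| + 2 * |U| + (torusBand L k - μ) ^ 2 / |k₀| + β * (|torusBand L k - μ| + |U|) ^ 2) := by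
  have hkr : k₀ ≠ 0 := ne_zero_of_cexp_eq_neg_one hk
  have hkc : (k₀ : ℂ) ≠ 0 := by exact_mod_cast hkr
  have hik : (I * k₀ : ℂ) ≠ 0 := mul_ne_zero I_ne_zero hkc
  set ξ : ℝ := torusBand L k - μ with hξ
  set H' := hubbardTorusWith 2 L 1 U μ with hH'
  set A : Matrix (Finset (Orb (FermionTorus 2 L))) _ ℂ := momentumAnnihilation k 0 with hA
  set B : Matrix (Finset (Orb (FermionTorus 2 L))) _ ℂ := momentumCreation k 0 with hB
  set G : ℂ := ∫ τ in (0 : ℝ)..β, cexp (I * k₀ * τ) * gibbsState β H' (imagTimeEvolve H' (τ : ℂ) A * B) with hG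
  set m₁ : ℂ := gibbsState β H' ((H' * A - A * H') * B + B * (H' * A - A * H')) with hm₁
  set D : ℂ := -I * k₀ + (ξ : ℂ) with hD
  -- the three inputs
  have hmain : ‖G + 1 / (I * k₀) - m₁ / (I * k₀) ^ 2‖ ≤ β * (|ξ| + |U|) ^ 2 / k₀ ^ 2 := by
    have h := norm_matsubaraGreen_sub_sumRules_le hL U μ hβ k hk
    rw [gibbsState_momentum_car, ← hH', ← hA, ← hB, ← hG, ← hm₁] at h
    simpa only [one_div] using h
  have hm₁n : ‖m₁‖ ≤ 2 * (|ξ| + |U|) := norm_gibbsState_firstMoment_le hL U μ β k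
  -- `D ≠ 0` and its norm
  have hDne : D ≠ 0 := by
    intro h
    have := congrArg Complex.im h
    simp [hD] at this
    exact hkr this
  have hDnorm : ‖D‖ ^ 2 = k₀ ^ 2 + ξ ^ 2 := by
    rw [Complex.sq_norm, Complex.normSq_apply, hD]
    simp
    ring
  have hk0D : |k₀| ≤ ‖D‖ := by
    have h1 : |k₀| = |D.im| := by simp [hD]
    rw [h1]; exact Complex.abs_im_le_norm D
  -- algebra (uses only `ik₀ + D = ξ`): `(1/D − G)·D² = [−(ξ + m₁) + ξ²/D − R (ik₀)²] · D²/(ik₀)²`, `R = G + 1/(ik₀) − m₁/(ik₀)²`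
  set R : ℂ := G + 1 / (I * k₀) - m₁ / (I * k₀) ^ 2 with hR
  have halg : (1 / D - G) * D ^ 2 = (-((ξ : ℂ) + m₁) + (ξ : ℂ) ^ 2 / D - R * (I * k₀) ^ 2) * (D ^ 2 / (I * k₀) ^ 2) := by
    have hξD : ((ξ : ℝ) : ℂ) = I * k₀ + D := by rw [hD]; ring
    rw [hR, hξD]
    field_simp
    ring
  rw [halg, norm_mul]
  have hfac : ‖D ^ 2 / (I * k₀) ^ 2‖ = 1 + ξ ^ 2 / k₀ ^ 2 := by
    rw [norm_div, norm_pow, norm_pow, hDnorm, norm_mul, Complex.norm_I, one_mul, Complex.norm_real, Real.norm_eq_abs, sq_abs]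
    field_simp
  rw [hfac, mul_comm]
  have hpos : 0 ≤ 1 + ξ ^ 2 / k₀ ^ 2 := by positivity
  refine mul_le_mul_of_nonneg_left ?_ hpos
  -- the bracket
  have h1 : ‖-((ξ : ℂ) + m₁)‖ ≤ 3 * |ξ| + 2 * |U| := by
    rw [norm_neg]
    calc ‖(ξ : ℂ) + m₁‖ ≤ ‖(ξ : ℂ)‖ + ‖m₁‖ := norm_add_le _ _
      _ ≤ |ξ| + 2 * (|ξ| + |U|) := by rw [Complex.norm_real, Real.norm_eq_abs]; gcongr
      _ = 3 * |ξ| + 2 * |U| := by ring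
  have h2 : ‖(ξ : ℂ) ^ 2 / D‖ ≤ ξ ^ 2 / |k₀| := by
    rw [norm_div, norm_pow, Complex.norm_real, Real.norm_eq_abs, sq_abs]
    exact div_le_div_of_nonneg_left (sq_nonneg ξ) (abs_pos.mpr hkr) hk0D
  have h3 : ‖R * (I * k₀) ^ 2‖ ≤ β * (|ξ| + |U|) ^ 2 := by
    rw [norm_mul, norm_pow, norm_mul, Complex.norm_I, one_mul, Complex.norm_real, Real.norm_eq_abs, sq_abs]
    have hk2 : 0 < k₀ ^ 2 := by positivity
    calc ‖R‖ * k₀ ^ 2 ≤ β * (|ξ| + |U|) ^ 2 / k₀ ^ 2 * k₀ ^ 2 := mul_le_mul_of_nonneg_right hmain hk2.le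
      _ = β * (|ξ| + |U|) ^ 2 := by field_simp
  calc ‖-((ξ : ℂ) + m₁) + (ξ : ℂ) ^ 2 / D - R * (I * k₀) ^ 2‖
      ≤ ‖-((ξ : ℂ) + m₁)‖ + ‖(ξ : ℂ) ^ 2 / D‖ + ‖R * (I * k₀) ^ 2‖ := norm_sub_le_of_le (norm_add_le _ _) le_rfl
    _ ≤ 3 * |ξ| + 2 * |U| + ξ ^ 2 / |k₀| + β * (|ξ| + |U|) ^ 2 := by gcongr

/-- Fermionic frequencies are at least `π/β` in size: `π/β ≤ |fermiMatsubara β m|` for `β > 0`. -/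
theorem pi_div_le_abs_fermiMatsubara {β : ℝ} (hβ : 0 < β) (m : ℤ) : Real.pi / β ≤ |fermiMatsubara β m| := by
  rw [fermiMatsubara, abs_div, abs_of_pos hβ, abs_mul, abs_of_pos Real.pi_pos]
  refine div_le_div_of_nonneg_right (le_mul_of_one_le_right Real.pi_pos.le ?_) hβ.le
  rcases le_or_gt 0 m with hm | hm
  · rw [abs_of_nonneg (by positivity)]
    have : (0 : ℝ) ≤ m := by exact_mod_cast hm
    linarith
  · have : (m : ℝ) ≤ -1 := by exact_mod_cast (Int.le_sub_one_of_lt hm)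
    rw [abs_of_neg (by linarith)]
    linarith

/-- **COROLLARY (the form clause (i) of the VL text wants): a bound INDEPENDENT of `L`, `k` and the frequency.**  For `β > 0`, `L ≥ 3`, every
Matsubara integer `m` (`k₀ = (2m+1)π/β`) and every torus momentum `k`:
`‖(ĝ − 𝒢)(−ik₀ + ξ)²‖ ≤ (1 + (4+|μ|)²β²/π²)·(3(4+|μ|) + 2|U| + (4+|μ|)²β/π + β(4+|μ|+|U|)²)`. -/
theorem norm_reamputated_matsubaraGreen_le_uniform (hL : 3 ≤ L) (U μ : ℝ) {β : ℝ} (hβ : 0 < β) (k : TorusSite 2 L) (m : ℤ) :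
    ‖(1 / (-I * (fermiMatsubara β m : ℝ) + ((torusBand L k - μ : ℝ) : ℂ)) -
          ∫ τ in (0 : ℝ)..β, cexp (I * (fermiMatsubara β m : ℝ) * τ) * gibbsState β (hubbardTorusWith 2 L 1 U μ)
            (imagTimeEvolve (hubbardTorusWith 2 L 1 U μ) (τ : ℂ) (momentumAnnihilation k 0) * momentumCreation k 0)) *
        (-I * (fermiMatsubara β m : ℝ) + ((torusBand L k - μ : ℝ) : ℂ)) ^ 2‖ ≤
      (1 + (4 + |μ|) ^ 2 * β ^ 2 / Real.pi ^ 2) *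
        (3 * (4 + |μ|) + 2 * |U| + (4 + |μ|) ^ 2 * β / Real.pi + β * (4 + |μ| + |U|) ^ 2) := by
  have hk := cexp_fermiMatsubara_mul_beta hβ.ne' m
  have h := norm_reamputated_matsubaraGreen_le hL U μ hβ.le k hk
  refine h.trans ?_
  set ξ : ℝ := torusBand L k - μ with hξ
  set k₀ : ℝ := fermiMatsubara β m with hk₀
  have hk₀ : Real.pi / β ≤ |k₀| := pi_div_le_abs_fermiMatsubara hβ m
  have hπβ : 0 < Real.pi / β := div_pos Real.pi_pos hβ
  have hk₀pos : 0 < |k₀| := lt_of_lt_of_le hπβ hk₀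
  have hξle : |ξ| ≤ 4 + |μ| := by
    rw [hξ]
    calc |torusBand L k - μ| ≤ |torusBand L k| + |μ| := abs_sub _ _
      _ ≤ 4 + |μ| := by gcongr; exact abs_le.mpr ⟨by linarith [neg_four_le_torusBand L k], torusBand_le_four L k⟩
  have hξ2 : ξ ^ 2 ≤ (4 + |μ|) ^ 2 := by
    calc ξ ^ 2 = |ξ| ^ 2 := (sq_abs ξ).symm
      _ ≤ (4 + |μ|) ^ 2 := by gcongr
  -- `1/k₀² ≤ β²/π²`, `1/|k₀| ≤ β/π`
  have hinv1 : 1 / |k₀| ≤ β / Real.pi := by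
    rw [div_le_div_iff₀ hk₀pos Real.pi_pos, one_mul]
    calc Real.pi = β * (Real.pi / β) := by field_simp
      _ ≤ β * |k₀| := by gcongr
  have hinv2 : 1 / k₀ ^ 2 ≤ β ^ 2 / Real.pi ^ 2 := by
    have := mul_le_mul hinv1 hinv1 (by positivity) (by positivity)
    calc 1 / k₀ ^ 2 = 1 / |k₀| * (1 / |k₀|) := by rw [← sq_abs]; field_simp
      _ ≤ β / Real.pi * (β / Real.pi) := this
      _ = β ^ 2 / Real.pi ^ 2 := by ring
  have hA : 1 + ξ ^ 2 / k₀ ^ 2 ≤ 1 + (4 + |μ|) ^ 2 * β ^ 2 / Real.pi ^ 2 := by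
    have : ξ ^ 2 / k₀ ^ 2 = ξ ^ 2 * (1 / k₀ ^ 2) := by ring
    rw [this, mul_div_assoc]
    gcongr
  have hB : 3 * |ξ| + 2 * |U| + ξ ^ 2 / |k₀| + β * (|ξ| + |U|) ^ 2 ≤
      3 * (4 + |μ|) + 2 * |U| + (4 + |μ|) ^ 2 * β / Real.pi + β * (4 + |μ| + |U|) ^ 2 := by
    have : ξ ^ 2 / |k₀| = ξ ^ 2 * (1 / |k₀|) := by ring
    rw [this, mul_div_assoc]
    gcongr
  exact mul_le_mul hA hB (by positivity) (by positivity)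

end Summit.HubbardSuperconductivity.HubbardSuperconductivity.Theorems.ThermalGreen

end
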